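import Literature.Computability.Complexity.GateEliminationCase54Q13

/-!
# Gate elimination: Case 5.4.1.4.2.3 of Li–Yang's Theorem 4.1

"Assume that `F` is an ∧-type gate. Since `u ≠ t`, we can substitute constants to `u` and `t` to
trivialize `E` and `F`. After this, `D` will become a `0`-gate, and by removing it via Rule 1, we
can make `z` a `0`-gate [variable], and hence non-influential (recall that `z` being unprotected is
the assumption of Case 5.4.1.4). This allows us to make `3` variables non-influential by `2`
substitutions, giving us `Δμ ≥ 3α_I/2 ≥ δ`." (ECCC TR21-023, §4.1, Case 5.4.1.4.2.3; the paper's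
`u`, `z` are our `u'`, `u`.) PROVED here as `stepGoal_quad23_and`.

## References

* J. Li, T. Yang, *3.1n − o(n) circuit lower bounds for explicit functions*, STOC 2022;
  ECCC TR21-023, §4.1 (Case 5.4.1.4.2.3), Lemma 3.11.
-/

namespace Literature.Computability.Complexity

open Finset

namespace Semicircuit

variable {n : ℕ} {C : Semicircuit n} {f : (Fin n → ZMod 2) → Bool} {R : RdqSource n} {d : ℕ}
  {αφ αI αQ : ℝ} {G : Fin C.m} {x y : Fin n} {B C' D : Fin C.m} {aX aB aC aD : Fin 2}

/-- **Case 5.4.1.4.2.3 of the proof of Thm. 4.1** (the other reader `F` of `D` is ∧-type, reading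
`D` and a variable `u' ≠ t`): the killing constants to `u'` and `t` trivialize `F` and `E`; then
`D` is a `0`-gate, deleted, and `u` a `0`-variable: `u'`, `t`, `u` leave the influential set,
`Δμ ≥ 3α_I ≥ 2δ`. [cite: LiYang2022, §4.1 (Case 5.4.1.4.2.3)] -/
theorem stepGoal_quad23_and (hf : IsAffineDisperser f d) (hd : 2 * d + 2 < R.dim) (hF : C.Fair)
    (hC : C.ComputesRestr f R) (hS : C.Standing R) (hcfg : C.Case5Config G x y B C' D aX aB aC aD)
    (hφ0 : 0 < αφ) (hφ : αφ < 1 / 2) (hI0 : 0 < αI)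
    {E : Fin C.m} {aE : Fin 2} {u : Fin n} (hIu : C.arg D aD.rev = .var u)
    (hup : ¬ R.Protected u) (hu1 : C.fanout (.var u) = 1) (hD2 : C.fanout (.gate D) = 2)
    (hEand : IsAndOp (C.op E)) (hED : C.arg E aE = .gate D)
    {t : Fin n} {F : Fin C.m} {aF : Fin 2} {u' : Fin n} (hEt : C.arg E aE.rev = .var t) (hFE : F ≠ E)
    (hFD : C.arg F aF = .gate D) (hFu : C.arg F aF.rev = .var u') (hut : u' ≠ t) (hFand : IsAndOp (C.op F)) :
    C.StepGoal f R αφ αI αQ := by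
  classical
  have hφ' := hφ0.le
  have hI' := hI0.le
  have hN := hS.normalized.1
  have hGK := hcfg.G_not_mem
  have hDK : D ∉ C.xorPart := fun hDK => hGK (C.mem_of_arg_eq D hDK aD G hcfg.arg_D)
  have hEK : E ∉ C.xorPart := C.not_mem_xorPart_of_isAndOp hEand
  have hED' : E ≠ D := fun h => by rw [h] at hED; exact C.arg_ne_self_of_not_mem hDK _ hED
  have hFD' : F ≠ D := fun h => by rw [h] at hFD; exact C.arg_ne_self_of_not_mem hDK _ hFD
  have hDG := hcfg.D_ne_G
  have hEG : E ≠ G := by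
    intro h; rw [h] at hED
    rcases fin2_eq_or_eq_rev aX aE with e' | e'
    · rw [e', hcfg.arg_G_x] at hED; cases hED
    · rw [e', hcfg.arg_G_y] at hED; cases hED
  have hFG : F ≠ G := by
    intro h; rw [h] at hFD
    rcases fin2_eq_or_eq_rev aX aF with e' | e'
    · rw [e', hcfg.arg_G_x] at hFD; cases hFD
    · rw [e', hcfg.arg_G_y] at hFD; cases hFD
  have htu : t ≠ u := by intro h; rw [h] at hEt; have := two_le_fanout hIu hEt hED'.symm; omega
  have huu : u' ≠ u := by intro h; rw [h] at hFu; have := two_le_fanout hIu hFu hFD'.symm; omega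
  have ht : R.Free t := free_of_reads hC hEt
  have htp : ¬ R.Protected t := fun h => hS.protected_not_and t h E aE.rev hEt hEand
  have hu' : R.Free u' := free_of_reads hC hFu
  have hup' : ¬ R.Protected u' := fun h => hS.protected_not_and u' h F aF.rev hFu hFand
  have hDout : C.out ≠ .gate D := out_ne_of_read_bYacyclic hS hEK ⟨aE, hED⟩
  obtain ⟨ko, hko⟩ := exists_out_eq_gate' hf hF hC (by omega)
  -- `D` is read once by `E`, once by `F`, and by nobody else
  have honlyD : ∀ k a, C.arg k a = .gate D → (k = E ∧ a = aE) ∨ (k = F ∧ a = aF) := by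
    intro k a h
    by_cases hkE : k = E
    · left; refine ⟨hkE, ?_⟩
      rw [hkE] at h
      rcases fin2_eq_or_eq_rev aE a with e' | e'
      · exact e'
      · rw [e', hEt] at h; cases h
    by_cases hkF : k = F
    · right; refine ⟨hkF, ?_⟩
      rw [hkF] at h
      rcases fin2_eq_or_eq_rev aF a with e' | e'
      · exact e'
      · rw [e', hFu] at h; cases h
    · exfalso
      have := three_le_fanout hED hFD h hFE.symm (fun h' => hkE h'.symm) (fun h' => hkF h'.symm)
      omega
  -- step 1: `u' := c₁` (killing `F`), step 2: `t := c₂` (killing `E`)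
  obtain ⟨c₁, hc₁⟩ := exists_trivializing hFand aF.rev
  obtain ⟨c₂, hc₂⟩ := exists_trivializing hEand aE.rev
  let c₁' : ZMod 2 := finTwoEquiv.symm c₁
  let c₂' : ZMod 2 := finTwoEquiv.symm c₂
  have hc₁' : finTwoEquiv c₁' = c₁ := finTwoEquiv.apply_symm_apply c₁
  have hc₂' : finTwoEquiv c₂' = c₂ := finTwoEquiv.apply_symm_apply c₂
  let C₁ := C.substConst u' (finTwoEquiv c₁')
  let R₁ := R.assignFree u' c₁' hu' hup'
  have hF₁ : C₁.Fair := hF.substConst u' _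
  have hC₁ : C₁.ComputesRestr f R₁ := hC.substConst_assignFree hu' hup' c₁'
  have hP₁ : C₁.IsPacking (C.substConstPacking u' (finTwoEquiv c₁') ∅) := C.isPacking_empty.substConst
  have ht₁ : R₁.Free t := (RdqSource.free_assignFree_iff hu' hup' t).mpr ⟨ht, hut.symm⟩
  have htp₁ : ¬ R₁.Protected t := fun h => htp ((RdqSource.protected_assignFree_iff hu' hup' t).mp h)
  let C₂ := C₁.substConst t (finTwoEquiv c₂')
  let R₂ := R₁.assignFree t c₂' ht₁ htp₁
  have hF₂ : C₂.Fair := hF₁.substConst t _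
  have hC₂ : C₂.ComputesRestr f R₂ := hC₁.substConst_assignFree ht₁ htp₁ c₂'
  have hP₂ : C₂.IsPacking (C₁.substConstPacking t (finTwoEquiv c₂') (C.substConstPacking u' (finTwoEquiv c₁') ∅)) := hP₁.substConst
  have hdim₂ : R₂.dim + 2 = R.dim := by
    have h1 := RdqSource.dim_assignFree (b := c₂') ht₁ htp₁
    have h2 := RdqSource.dim_assignFree (b := c₁') hu' hup'
    change R₂.dim + 1 = R₁.dim at h1
    change R₁.dim + 1 = R.dim at h2
    omega
  -- wires of `C₂`
  have harg₂ : ∀ k a, C₂.arg k a = ((C.arg k a).substConst u' (finTwoEquiv c₁')).substConst t (finTwoEquiv c₂') := fun _ _ => rfl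
  have hgate₂ : ∀ {k : Fin C.m} {a : Fin 2} {g : Fin C.m}, C₂.arg k a = .gate g ↔ C.arg k a = .gate g := by
    intro k a g; rw [harg₂, Node.substConst_eq_gate_iff, Node.substConst_eq_gate_iff]
  have hvar₂ : ∀ {k : Fin C.m} {a : Fin 2} {v : Fin n}, v ≠ u' → v ≠ t → (C₂.arg k a = .var v ↔ C.arg k a = .var v) := by
    intro k a v hvu hvt
    rw [harg₂]
    cases hka : C.arg k a with
    | const c => exact ⟨(fun h => by cases h), fun h => by cases h⟩
    | var i =>
      by_cases hiu : i = u'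
      · rw [hiu, Node.substConst_var_self]; exact ⟨(fun h => by cases h), fun h => by cases h; exact absurd rfl hvu⟩
      · rw [Node.substConst_var_of_ne hiu]
        by_cases hit : i = t
        · rw [hit, Node.substConst_var_self]; exact ⟨(fun h => by cases h), fun h => by cases h; exact absurd rfl hvt⟩
        · rw [Node.substConst_var_of_ne hit]
    | gate g => exact ⟨(fun h => by cases h), fun h => by cases h⟩
  have hFu₂ : C₂.arg F aF.rev = .const c₁ := by
    rw [harg₂, hFu, Node.substConst_var_self]
    show Node.const (finTwoEquiv c₁') = Node.const c₁
    rw [hc₁']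
  have hEt₂ : C₂.arg E aE.rev = .const c₂ := by
    rw [harg₂, hEt, Node.substConst_var_of_ne hut.symm, Node.substConst_var_self, hc₂']
  have hFD₂ : C₂.arg F aF = .gate D := hgate₂.mpr hFD
  have hED₂ : C₂.arg E aE = .gate D := hgate₂.mpr hED
  have hDG₂ : C₂.arg D aD = .gate G := hgate₂.mpr hcfg.arg_D
  have hDu₂ : C₂.arg D aD.rev = .var u := (hvar₂ huu.symm htu.symm).mpr hIu
  have hC₂out : C₂.out = .gate ko := by show (C.out.substConst u' _).substConst t _ = _; rw [hko]; rfl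
  -- step 3: `F` is trivialized
  have htrivF : C₂.liveFn F aF.rev c₁ false = C₂.liveFn F aF.rev c₁ true := hc₁
  have hout₂F : C₂.out ≠ .gate F := out_ne_of_trivialized hf (by omega) hF₂ hC₂ hFu₂ htrivF
  let E₁ := elimDataWTriv hF₂ hC₂ hP₂ hFu₂ htrivF hout₂F hφ' hI' αQ
  have hr₁ : ∃ r₁, E₁.repl = .const r₁ := ⟨_, rfl⟩
  obtain ⟨kE₁, hkE₁⟩ := E₁.ι_surj E hFE.symm
  obtain ⟨kD₁, hkD₁⟩ := E₁.ι_surj D hFD'.symm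
  have hE₁c : E₁.C'.arg kE₁ aE.rev = .const c₂ := (E₁.arg_eq_const_iff kE₁ aE.rev c₂).mpr (Or.inl (by rw [hkE₁]; exact hEt₂))
  have hE₁D : E₁.C'.arg kE₁ aE = .gate kD₁ := by rw [E₁.arg_eq_gate_iff, hkE₁, hkD₁]; exact Or.inl hED₂
  have hopE₁ : E₁.C'.op kE₁ = C.op E := by rw [elimDataWTriv_op, hkE₁]
  -- step 4: `E` is trivialized
  have htrivE : E₁.C'.liveFn kE₁ aE.rev c₂ false = E₁.C'.liveFn kE₁ aE.rev c₂ true := by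
    unfold liveFn at hc₂ ⊢; rw [hopE₁]; exact hc₂
  have hout₁E : E₁.C'.out ≠ .gate kE₁ := out_ne_of_trivialized hf (by omega) E₁.fair E₁.computes hE₁c htrivE
  let E₂ := elimDataWTriv E₁.fair E₁.computes E₁.packing hE₁c htrivE hout₁E hφ' hI' αQ
  have hr₂ : ∃ r₂, E₂.repl = .const r₂ := ⟨_, rfl⟩
  have hkDE₁ : kD₁ ≠ kE₁ := fun h => hED' (by rw [← hkE₁, ← hkD₁, h])
  obtain ⟨kD₂, hkD₂⟩ := E₂.ι_surj kD₁ hkDE₁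
  -- step 5: `D` is a `0`-gate: delete it
  have hfD₁ : E₁.C'.fanout (.gate kD₁) = 1 := by
    obtain ⟨r₁, hr₁'⟩ := hr₁
    have h1 := E₁.fanout_gate_add (k' := kD₁) (by rw [hr₁']; exact fun h => by cases h)
    have h2 : 1 ≤ (univ.filter fun a : Fin 2 => C₂.arg F a = .gate D).card :=
      card_pos.mpr ⟨aF, mem_filter.mpr ⟨mem_univ _, hFD₂⟩⟩
    have h4 := one_le_fanout_of_arg_eq hE₁D
    rw [hkD₁] at h1
    have h3 : C₂.fanout (.gate D) = 2 := by
      show (C₁.substConst t (finTwoEquiv c₂')).fanout (.gate D) = 2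
      rw [C₁.fanout_substConst_gate]; show (C.substConst u' (finTwoEquiv c₁')).fanout (.gate D) = 2
      rw [C.fanout_substConst_gate]; exact hD2
    omega
  have hfD₂ : E₂.C'.fanout (.gate kD₂) = 0 := by
    obtain ⟨r₂, hr₂'⟩ := hr₂
    have h1 := E₂.fanout_gate_add (k' := kD₂) (by rw [hr₂']; exact fun h => by cases h)
    rw [hkD₂, hfD₁] at h1
    have h2 : 1 ≤ (univ.filter fun a : Fin 2 => E₁.C'.arg kE₁ a = .gate kD₁).card :=
      card_pos.mpr ⟨aE, mem_filter.mpr ⟨mem_univ _, hE₁D⟩⟩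
    omega
  have hno₃ : ∀ k a, E₂.C'.arg k a ≠ .gate kD₂ := (fanout_eq_zero_iff _ _).mp hfD₂
  have hout₂D : E₂.C'.out ≠ .gate kD₂ := by
    intro h2
    have e2 := E₂.out_eq; rw [if_neg hout₁E, h2] at e2
    change Node.gate (E₂.ι kD₂) = E₁.C'.out at e2; rw [hkD₂] at e2
    have e1 := E₁.out_eq; rw [if_neg hout₂F, ← e2, hC₂out] at e1
    change Node.gate (E₁.ι kD₁) = Node.gate ko at e1
    rw [hkD₁] at e1; cases e1; exact hDout hko
  let ε₃ := E₂.C'.skipEquiv kD₂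
  let C₃ := E₂.C'.removeGate kD₂ ε₃
  have hF₃ : C₃.Fair := E₂.fair.removeGate ε₃ hno₃
  have hC₃ : C₃.ComputesRestr f R₂ := E₂.computes.removeGate ε₃ E₂.fair hno₃ hout₂D
  -- wires of `D`'s image
  obtain ⟨kG₁, hkG₁⟩ := E₁.ι_surj G hFG.symm
  have hkGE₁ : kG₁ ≠ kE₁ := fun h => hEG (by rw [← hkE₁, ← hkG₁, h])
  obtain ⟨kG₂, hkG₂⟩ := E₂.ι_surj kG₁ hkGE₁
  have hD₁G : E₁.C'.arg kD₁ aD = .gate kG₁ := by rw [E₁.arg_eq_gate_iff, hkD₁, hkG₁]; exact Or.inl hDG₂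
  have hD₁u : E₁.C'.arg kD₁ aD.rev = .var u := by rw [E₁.arg_eq_var_iff, hkD₁]; exact Or.inl hDu₂
  have hD₂G : E₂.C'.arg kD₂ aD = .gate kG₂ := by rw [E₂.arg_eq_gate_iff, hkD₂, hkG₂]; exact Or.inl hD₁G
  have hD₂u : E₂.C'.arg kD₂ aD.rev = .var u := by rw [E₂.arg_eq_var_iff, hkD₂]; exact Or.inl hD₁u
  have hfG₂ : E₂.C'.fanout (.gate kG₂) ≤ 1 := by
    obtain ⟨r₁, hr₁'⟩ := hr₁; obtain ⟨r₂, hr₂'⟩ := hr₂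
    have h1 := E₁.fanout_gate_add (k' := kG₁) (by rw [hr₁']; exact fun h => by cases h)
    have h2 := E₂.fanout_gate_add (k' := kG₂) (by rw [hr₂']; exact fun h => by cases h)
    rw [hkG₂] at h2; rw [hkG₁] at h1
    have h3 : C₂.fanout (.gate G) = 1 := by
      show (C₁.substConst t (finTwoEquiv c₂')).fanout (.gate G) = 1
      rw [C₁.fanout_substConst_gate]; show (C.substConst u' (finTwoEquiv c₁')).fanout (.gate G) = 1
      rw [C.fanout_substConst_gate]; exact hcfg.fanout_G
    omega
  have hfu₂ : E₂.C'.fanout (.var u) ≤ 1 := by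
    obtain ⟨r₁, hr₁'⟩ := hr₁; obtain ⟨r₂, hr₂'⟩ := hr₂
    have h1 := E₁.fanout_var_add (i := u) (by rw [hr₁']; exact fun h => by cases h)
    have h2 := E₂.fanout_var_add (i := u) (by rw [hr₂']; exact fun h => by cases h)
    have h3 : C₂.fanout (.var u) = 1 := by
      show (C₁.substConst t (finTwoEquiv c₂')).fanout (.var u) = 1
      rw [C₁.fanout_substConst_var_of_ne t _ htu.symm]; show (C.substConst u' (finTwoEquiv c₁')).fanout (.var u) = 1
      rw [C.fanout_substConst_var_of_ne u' _ huu.symm]; exact hu1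
    omega
  have hvarD : ∀ a v, E₂.C'.arg kD₂ a = .var v → E₂.C'.fanout (.var v) ≤ 2 := by
    intro a v hv
    rcases fin2_eq_or_eq_rev aD a with e' | e'
    · rw [e', hD₂G] at hv; cases hv
    · rw [e', hD₂u] at hv; cases hv; omega
  have hgateD : ∀ a g, E₂.C'.arg kD₂ a = .gate g → E₂.C'.fanout (.gate g) ≤ 1 := by
    intro a g hg
    rcases fin2_eq_or_eq_rev aD a with e' | e'
    · rw [e', hD₂G] at hg; cases hg; exact hfG₂
    · rw [e', hD₂u] at hg; cases hg
  obtain ⟨P₃, hP₃, hpot₃⟩ := exists_packing_removeGate_noNew E₂.C' kD₂ ε₃ hno₃ E₂.packing hvarD hgateD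
  -- `u` is a `0`-variable at the end, unprotected
  have hfu₃ : C₃.fanout (.var u) = 0 := by
    have h1 := E₂.C'.fanout_removeGate_add kD₂ ε₃ hno₃ (v := .var u) (fun h => by cases h)
    have h2 : 1 ≤ (univ.filter fun a : Fin 2 => E₂.C'.arg kD₂ a = .var u).card :=
      card_pos.mpr ⟨aD.rev, mem_filter.mpr ⟨mem_univ _, hD₂u⟩⟩
    change C₃.fanout (.var u) + _ = _ at h1
    omega
  have hup₂ : ¬ R₂.Protected u := fun h =>
    hup ((RdqSource.protected_assignFree_iff hu' hup' u).mp ((RdqSource.protected_assignFree_iff ht₁ htp₁ u).mp h))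
  have huinf₂ : u ∈ E₂.C'.influential R₂ := E₂.C'.mem_influential_of_reads R₂ hD₂u
  have hinf₃ : ((C₃.influential R₂).card : ℝ) + 1 ≤ (E₂.C'.influential R₂).card := by
    have hsub : C₃.influential R₂ ⊆ (E₂.C'.influential R₂).erase u := by
      intro i hi
      rw [mem_erase]
      refine ⟨fun hiu => ?_, E₂.C'.influential_removeGate_subset kD₂ ε₃ hno₃ R₂ hi⟩
      rw [hiu] at hi
      unfold influential at hi; rw [mem_filter, hfu₃] at hi
      rcases hi.2 with h | h
      · omega
      · exact hup₂ h
    have h1 := card_le_card hsub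
    have h2 := card_erase_add_one huinf₂
    have : (C₃.influential R₂).card + 1 ≤ (E₂.C'.influential R₂).card := by omega
    exact_mod_cast this
  -- accounting
  have huinf : u' ∈ C.influential R := C.mem_influential_of_reads R hFu
  have hμ₁ := measure_substConst_le hφ' αI αQ C.isPacking_empty R R₁ u' (finTwoEquiv c₁')
  have hinf₁ : (1 : ℝ) ≤ ((C.influential R).card : ℝ) - (C₁.influential R₁).card := by
    have h1 : (C₁.influential R₁).card ≤ ((C.influential R).erase u').card :=
      card_le_card (C.influential_substConst_assignFree_subset hu' hup' c₁' (finTwoEquiv c₁'))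
    have h3 := card_erase_add_one huinf
    have : (C₁.influential R₁).card + 1 ≤ (C.influential R).card := by omega
    have : ((C₁.influential R₁).card : ℝ) + 1 ≤ (C.influential R).card := by exact_mod_cast this
    linarith
  have hq₁ : ((R.quadCount : ℝ) - (R₁.quadCount : ℝ)) = 0 := by
    have : R₁.quadCount = R.quadCount := RdqSource.quadCount_assignFree hu' hup'; rw [this]; ring
  have htinf₁ : t ∈ C₁.influential R₁ := C₁.mem_influential_of_reads R₁ (show C₁.arg E aE.rev = .var t by
    show (C.arg E aE.rev).substConst u' _ = _; rw [hEt, Node.substConst_var_of_ne hut.symm])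
  have hμ₂ := measure_substConst_le hφ' αI αQ hP₁ R₁ R₂ t (finTwoEquiv c₂')
  have hinf₂ : (1 : ℝ) ≤ ((C₁.influential R₁).card : ℝ) - (C₂.influential R₂).card := by
    have h1 : (C₂.influential R₂).card ≤ ((C₁.influential R₁).erase t).card :=
      card_le_card (C₁.influential_substConst_assignFree_subset ht₁ htp₁ c₂' (finTwoEquiv c₂'))
    have h3 := card_erase_add_one htinf₁
    have : (C₂.influential R₂).card + 1 ≤ (C₁.influential R₁).card := by omega
    have : ((C₂.influential R₂).card : ℝ) + 1 ≤ (C₁.influential R₁).card := by exact_mod_cast this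
    linarith
  have hq₂ : ((R₁.quadCount : ℝ) - (R₂.quadCount : ℝ)) = 0 := by
    have : R₂.quadCount = R₁.quadCount := RdqSource.quadCount_assignFree ht₁ htp₁; rw [this]; ring
  have hμE₁ := E₁.measure_le
  have hμE₂ := E₂.measure_le
  have hm₃ : (C₃.m : ℝ) + 1 = E₂.C'.m := by exact_mod_cast E₂.C'.removeGate_m_add_one kD₂ ε₃
  have hpot₃' : (C₃.potential P₃ : ℝ) ≤ E₂.C'.potential E₂.P' := by exact_mod_cast hpot₃
  have hμ₃ : C₃.measure αφ αI αQ P₃ R₂ ≤ E₂.C'.measure αφ αI αQ E₂.P' R₂ - 1 - αI := by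
    unfold measure
    nlinarith [mul_le_mul_of_nonneg_left hinf₃ hI', mul_le_mul_of_nonneg_left hpot₃' hφ']
  refine Or.inr ⟨2, by norm_num, by norm_num, C₃, R₂, P₃, hF₃, hC₃, hP₃, hdim₂, ?_⟩
  have hδ := two_liYangDelta_le_three αφ hI' αQ
  rw [hq₁] at hμ₁; rw [hq₂] at hμ₂
  have hαI₁ := mul_le_mul_of_nonneg_left hinf₁ hI'
  have hαI₂ := mul_le_mul_of_nonneg_left hinf₂ hI'
  push_cast
  nlinarith [hμ₁, hμ₂, hμE₁, hμE₂, hμ₃, hαI₁, hαI₂, hφ.le]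

end Semicircuit

end Literature.Computability.Complexity
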